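import Summits.BirchSwinnertonDyer.BirchSwinnertonDyer.Theorems.PrintCFramBottomClassIndexLawFiveLeSelmerCountCharacterSupply
import HarnessLib

/-!
# Route `PrintCFram`, crux C2 `BottomClassIndexLawFiveLe` (stmt-BirchSwinnertonDyer-20372), line
# `eisenstein-resource-bdp-line` (registry v22, stubs B1-level `stub_bsdp_of_level` / B1-sha `stub_bsdp_of_sha`):
# **THE CHARACTER SUPPLY COUNT IN `p`-RANKS** — an INDEPENDENT finite family `κ_i` (`i ∈ ι`) of admissible `θ`-isotypic
# characters of `Γ_L` gives `#H¹(Γ_ℚ, A; S) ≥ p^{#ι}`, hence, on the rank-one CM-ramified class under (LA),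
# **`p^{#ι} ≤ #Sel_p(W/ℚ)`** and **`p^{#ι − 1} ≤ #Ш(W/ℚ)[p]`**
# (cell `bsd-print-cfram`, width seat `bsd-line-cfram-p1-w7` g5; helper `--supports` 20372; 0 defs, 0 facts, 0 sorry;
# §4 CONDITIONAL on the tree's named fact `localEulerPoincareCharacteristic ℚ_v` exactly as `…SelmerCountCoalignedOfLocal`)

HONEST FRAMING. Nothing about BSD is proved here and no stub is closed. This is the `p`-RANK form of w2 g11's character supply
count `SelmerCount.sq_le_natCard_h1Unramified_of_two_characters` (p684559, the case `#ι = 2`) — step 3/4 of the p-rank LOWER bound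
of the B1-sha census (HOME/HANDOFF §w4 g10 FINAL, successor item (b)), the lower twin of w4 g10's
`natCard_selmerGroup_le_sq_mul_sq_of_evenChiTorsion_le` (p685197, `#Sel_p ≤ p²·t²`): pure group bookkeeping (the subgroup generated
by an independent commuting family of `#ι` elements of exponent `p` has at least `p^{#ι}` elements; admissibility is closed under
products), w2 g10's reverse bridge `natCard_characters_le_natCard_h1Unramified` (p682362), and — on the class — the QUANTITATIVE
form of w2 g10's lower bound: (LA) ⟹ CO-ALIGNED (`coaligned_of_forall_exists_adaptedRoot`, p681509, mod Milne I 2.8) ⟹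
`#R_rel(Φ) ≤ #Sel_p(W/ℚ)` (`natCard_h1Unramified_le_natCard_selmerGroup_of_coaligned`, p679505) and `#Sel_p = p · #Ш[p]` in rank one
(`ParitySplit.natCard_selmerGroup_eq_mul_of_rank_one`). The family of characters itself (Minkowski unit + `r` class radicals) is
`KummerRadical.exists_independent_kummer_characters` (this seat, file `…KummerManyCharacters`).

* §1 `prod_pow_apply`, `exists_eq_prod_pow_of_mem_closure_range` (every element of `closure (range κ)` is `∏ κ_i^{n_i}`, `n_i < p`),
  `finite_closure_range`, **`pow_card_le_natCard_closure_range`** (INDEPENDENT ⟹ `p^{#ι} ≤ #closure (range κ)`).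
* §2 admissibility of `∏ κ_i^{n_i}`: `isOpen_ker_prod_pow`, `prod_pow_apply_eq_one`, `prod_pow_apply_eq_pow`.
* §3 **`pow_card_le_natCard_h1Unramified_of_characters`** — bridge data + an admissible independent family ⊢ `p^{#ι} ≤ #h1Unramified A S`.
* §4 **`pow_card_le_natCard_selmerGroup_of_forall_exists_adaptedRoot_of_characters_of_cmRamified`** — class member (`W/ℚ` minimal
  with CM, `CMRamified W p`, `p ≥ 5`), rank one, `v ∋ p`, a stable line `Φ` of order `p` with character `θ` satisfying (LA) at `v`,
  `L/ℚ` Galois with `p ∤ [L:ℚ]` and `θ(res Γ_L) = 1`, an admissible independent family `κ : ι → (Γ_L →* ℤ/p)`, and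
  `localEulerPoincareCharacteristic ℚ_v` ⊢ **`p^{#ι} ≤ #Sel_p(W/ℚ)` ∧ `p^{#ι−1} ≤ #(Ш(W/ℚ) ⊓ Ш[p])`**.

THEOREMS ONLY; no definition, no named fact, no `sorry`. BSD is not proved by any of this; no summit statement is proved by this
seat. References: [Washington1997] §10.2; [Gras2003] Ch. II §5.4; [SerreGaloisCohomology1997] I.§2.6 (b); [MilneADT2006] I Thm. 2.8;
[SilvermanAEC2009] Thm. X.4.2.
-/

set_option autoImplicit false
-- `…BirchSwinnertonDyer.BirchSwinnertonDyer.Theorems…` is the problem's mandated namespace (D-0017).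
set_option linter.dupNamespace false

noncomputable section

open scoped Classical

namespace Summit.BirchSwinnertonDyer.BirchSwinnertonDyer.Theorems.PrintCFram.SelmerCount

open NumberField IsDedekindDomain Field WeierstrassCurve
open Literature.NumberTheory.EllipticCurves Literature.NumberTheory.GaloisRepresentations
  Literature.NumberTheory.EllipticCurves.GreenbergSelmer Literature.NumberTheory.EllipticCurves.Rank1Residual
open Summit.BirchSwinnertonDyer.Rank1Residual.X2.ResidualDevissageModules

/-! ## §1 An independent family of `#ι` characters of exponent `p` generates at least `p^{#ι}` characters -/

section Apply

variable {Γ : Type} [Group Γ] {p : ℕ} {ι : Type}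

/-- `(∏_{i ∈ s} κ_i^{n_i}) g = ∏_{i ∈ s} κ_i(g)^{n_i}`. [folklore] -/
theorem finset_prod_pow_apply (κ : ι → (Γ →* Multiplicative (ZMod p))) (n : ι → ℕ) (s : Finset ι) (g : Γ) :
    (∏ i ∈ s, κ i ^ n i) g = ∏ i ∈ s, κ i g ^ n i := by
  rw [MonoidHom.finsetProd_apply]
  exact Finset.prod_congr rfl fun i _ => MonoidHom.pow_apply _ _ _

/-- `(∏ κ_i^{n_i}) g = ∏ κ_i(g)^{n_i}`. [folklore] -/
theorem prod_pow_apply [Fintype ι] (κ : ι → (Γ →* Multiplicative (ZMod p))) (n : ι → ℕ) (g : Γ) :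
    (∏ i, κ i ^ n i) g = ∏ i, κ i g ^ n i :=
  finset_prod_pow_apply κ n Finset.univ g

end Apply

section Count

variable {Γ : Type} [Group Γ] {p : ℕ} [hp : Fact p.Prime] {ι : Type} [Fintype ι]

/-- Every element of the subgroup generated by a finite family of characters `κ_i : Γ →* ℤ/p` is `∏ κ_i^{n_i}` with `n_i < p`
(the characters commute and have exponent `p`). [folklore] -/
theorem exists_eq_prod_pow_of_mem_closure_range (κ : ι → (Γ →* Multiplicative (ZMod p)))
    {χ : Γ →* Multiplicative (ZMod p)} (h : χ ∈ Subgroup.closure (Set.range κ)) :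
    ∃ n : ι → ℕ, (∀ i, n i < p) ∧ χ = ∏ i, κ i ^ n i := by
  -- without the bound on the exponents, by closure induction
  have h' : ∃ n : ι → ℕ, χ = ∏ i, κ i ^ n i := by
    refine Subgroup.closure_induction (p := fun χ _ => ∃ n : ι → ℕ, χ = ∏ i, κ i ^ n i) ?_ ?_ ?_ ?_ h
    · rintro _ ⟨i, rfl⟩
      refine ⟨fun j => if j = i then 1 else 0, ?_⟩
      show κ i = ∏ j, κ j ^ (if j = i then 1 else 0)
      rw [Finset.prod_eq_single i (fun j _ hj => by rw [if_neg hj, pow_zero]) (fun hi => (hi (Finset.mem_univ i)).elim),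
        if_pos rfl, pow_one]
    · exact ⟨fun _ => 0, by simp only [pow_zero, Finset.prod_const_one]⟩
    · rintro χ₁ χ₂ _ _ ⟨n₁, rfl⟩ ⟨n₂, rfl⟩
      refine ⟨fun i => n₁ i + n₂ i, ?_⟩
      show (∏ i, κ i ^ n₁ i) * ∏ i, κ i ^ n₂ i = ∏ i, κ i ^ (n₁ i + n₂ i)
      rw [← Finset.prod_mul_distrib]
      exact Finset.prod_congr rfl fun i _ => (pow_add _ _ _).symm
    · rintro χ _ ⟨n, rfl⟩
      refine ⟨fun i => n i * (p - 1), ?_⟩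
      show (∏ i, κ i ^ n i)⁻¹ = ∏ i, κ i ^ (n i * (p - 1))
      rw [← Finset.prod_inv_distrib]
      refine Finset.prod_congr rfl fun i _ => inv_eq_of_mul_eq_one_right ?_
      rw [← pow_add, add_comm, ← Nat.mul_succ, Nat.succ_eq_add_one, Nat.sub_add_cancel hp.out.one_le, mul_comm, pow_mul,
        character_pow_prime, one_pow]
  obtain ⟨n, rfl⟩ := h'
  refine ⟨fun i => n i % p, fun i => Nat.mod_lt _ hp.out.pos, ?_⟩
  show ∏ i, κ i ^ n i = ∏ i, κ i ^ (n i % p)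
  exact Finset.prod_congr rfl fun i _ => pow_eq_pow_mod _ (character_pow_prime (κ i))

/-- The subgroup generated by a finite family of characters `Γ →* ℤ/p` is finite (at most `p^{#ι}` elements). [folklore] -/
theorem finite_closure_range (κ : ι → (Γ →* Multiplicative (ZMod p))) :
    Finite (Subgroup.closure (Set.range κ)) := by
  let f : (ι → Fin p) → (Γ →* Multiplicative (ZMod p)) := fun n => ∏ i, κ i ^ (n i : ℕ)
  have hsub : ((Subgroup.closure (Set.range κ) : Subgroup _) : Set (Γ →* Multiplicative (ZMod p))) ⊆ Set.range f := by
    intro χ hχ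
    obtain ⟨n, hn, rfl⟩ := exists_eq_prod_pow_of_mem_closure_range κ hχ
    exact ⟨fun i => ⟨n i, hn i⟩, rfl⟩
  exact ((Set.finite_range f).subset hsub).to_subtype

/-- **An INDEPENDENT family of `#ι` characters generates at least `p^{#ι}` characters.** If `∏ κ_i^{n_i} = 1` forces `p ∣ n_i` for
every `i`, then `n ↦ ∏ κ_i^{n_i}`, `(ℤ/p)^ι → closure (range κ)`, is injective, so `p^{#ι} ≤ #closure (range κ)` (in fact `=`).
[folklore] -/
theorem pow_card_le_natCard_closure_range {κ : ι → (Γ →* Multiplicative (ZMod p))}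
    (hind : ∀ n : ι → ℕ, ∏ i, κ i ^ n i = 1 → ∀ i, p ∣ n i) :
    p ^ Fintype.card ι ≤ Nat.card (Subgroup.closure (Set.range κ)) := by
  haveI : NeZero p := ⟨hp.out.ne_zero⟩
  haveI := finite_closure_range κ
  set V := Subgroup.closure (Set.range κ) with hV
  have hmemV : ∀ i, κ i ∈ V := fun i => Subgroup.subset_closure ⟨i, rfl⟩
  let f : (ι → ZMod p) → V := fun n => ⟨∏ i, κ i ^ (n i).val, V.prod_mem fun i _ => V.pow_mem (hmemV i) _⟩
  -- `p ∣ x.val + (p − x'.val)` forces `x = x'`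
  have hmod : ∀ {x x' : ZMod p}, p ∣ x.val + (p - x'.val) → x = x' := by
    intro x x' hdvd
    have hx' : x'.val ≤ p := (ZMod.val_lt x').le
    have h0 : ((x.val + (p - x'.val) : ℕ) : ZMod p) = 0 := (ZMod.natCast_eq_zero_iff _ _).2 hdvd
    rw [Nat.cast_add, Nat.cast_sub hx', ZMod.natCast_zmod_val, ZMod.natCast_self, ZMod.natCast_zmod_val, zero_sub,
      ← sub_eq_add_neg, sub_eq_zero] at h0
    exact h0
  have hf : Function.Injective f := by
    intro n n' h
    have h' : ∏ i, κ i ^ (n i).val = ∏ i, κ i ^ (n' i).val := by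
      simpa only [f, Subtype.mk.injEq] using h
    have key : ∏ i, κ i ^ ((n i).val + (p - (n' i).val)) = 1 := by
      calc ∏ i, κ i ^ ((n i).val + (p - (n' i).val))
          = (∏ i, κ i ^ (n i).val) * ∏ i, κ i ^ (p - (n' i).val) := by
            rw [← Finset.prod_mul_distrib]; exact Finset.prod_congr rfl fun i _ => pow_add _ _ _
        _ = (∏ i, κ i ^ (n' i).val) * ∏ i, κ i ^ (p - (n' i).val) := by rw [h']
        _ = ∏ i, κ i ^ ((n' i).val + (p - (n' i).val)) := by
            rw [← Finset.prod_mul_distrib]; exact Finset.prod_congr rfl fun i _ => (pow_add _ _ _).symm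
        _ = 1 := by
            rw [Finset.prod_eq_one]
            intro i _
            rw [Nat.add_sub_cancel' (ZMod.val_lt (n' i)).le, character_pow_prime]
    funext i
    exact hmod (hind _ key i)
  calc p ^ Fintype.card ι = Nat.card (ι → ZMod p) := by
        rw [Nat.card_eq_fintype_card, Fintype.card_fun, ZMod.card]
    _ ≤ Nat.card V := Nat.card_le_card_of_injective f hf

end Count

/-! ## §2 Admissibility is closed under products -/

section Admissible

variable {Γ : Type} [Group Γ] {p : ℕ} {ι : Type} [Fintype ι]

/-- The kernel of `∏ κ_i^{n_i}` contains `⋂ ker κ_i`; so it is open when all the `ker κ_i` are. [folklore] -/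
theorem isOpen_ker_prod_pow [TopologicalSpace Γ] [ContinuousMul Γ] {κ : ι → (Γ →* Multiplicative (ZMod p))}
    (h : ∀ i, IsOpen ((κ i).ker : Set Γ)) (n : ι → ℕ) :
    IsOpen ((∏ i, κ i ^ n i).ker : Set Γ) := by
  refine Subgroup.isOpen_mono (H₁ := ⨅ i, (κ i).ker) (fun σ hσ => ?_) ?_
  · rw [Subgroup.mem_iInf] at hσ
    rw [MonoidHom.mem_ker, prod_pow_apply]
    exact Finset.prod_eq_one fun i _ => by rw [(MonoidHom.mem_ker).1 (hσ i), one_pow]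
  · rw [Subgroup.coe_iInf]
    exact isOpen_iInter_of_finite fun i => h i

/-- If every `κ_i` kills `g` then so does `∏ κ_i^{n_i}` (used for the inertia groups above the places outside `S`). [folklore] -/
theorem prod_pow_apply_eq_one {κ : ι → (Γ →* Multiplicative (ZMod p))} {g : Γ} (h : ∀ i, κ i g = 1) (n : ι → ℕ) :
    (∏ i, κ i ^ n i) g = 1 := by
  rw [prod_pow_apply]
  exact Finset.prod_eq_one fun i _ => by rw [h i, one_pow]

/-- If every `κ_i` satisfies the eigen-law `κ g' = (κ g)^m` then so does `∏ κ_i^{n_i}` (used with `g' = θ_γ g`, `m = θ(γ)`: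
`θ`-isotypy under the outer action of `Γ_ℚ` is closed under products). [folklore] -/
theorem prod_pow_apply_eq_pow {κ : ι → (Γ →* Multiplicative (ZMod p))} {g g' : Γ} {m : ℕ}
    (h : ∀ i, κ i g' = κ i g ^ m) (n : ι → ℕ) :
    (∏ i, κ i ^ n i) g' = (∏ i, κ i ^ n i) g ^ m := by
  rw [prod_pow_apply, prod_pow_apply, ← Finset.prod_pow]
  exact Finset.prod_congr rfl fun i _ => by rw [h i, ← pow_mul, ← pow_mul, mul_comm]

end Admissible

/-! ## §3 An admissible independent family ⟹ `p^{#ι} ≤ #H¹(Γ_ℚ, A; S)` -/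

section Supply

variable {p : ℕ} [hp : Fact p.Prime]
variable {A : Type} [AddCommGroup A] [DistribMulAction (absoluteGaloisGroup ℚ) A] [TopologicalSpace A] [DiscreteTopology A]
variable {L : Type} [Field L] [NumberField L] [IsGalois ℚ L]
variable {ι : Type} [Fintype ι]

/-- **THE CHARACTER SUPPLY COUNT IN `p`-RANKS.** `A` a discrete `Γ_ℚ`-module of prime order `p` with continuous orbit maps, acted on
through `θ : Γ_ℚ →* 𝔽_pˣ`; `L/ℚ` finite Galois with `p ∤ [L:ℚ]` and `θ(res Γ_L) = 1`; `S` a finite set of places of `ℚ`;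
`κ : ι → (Γ_L →* 𝔽_p)` a finite family of characters with open kernels, trivial on the inertia group of every prime of `\bar ℤ_L` above
a place `u` with `u ∩ ℚ ∉ S`, `θ`-isotypic under the outer action of `Γ_ℚ` (`κ_i(θ_γ σ) = κ_i(σ)^{θ γ}`), and INDEPENDENT
(`∏ κ_i^{n_i} = 1 → ∀ i, p ∣ n_i`). THEN **`p^{#ι} ≤ #h1Unramified A S`**: the subgroup `V = ⟨κ_i⟩` has `≥ p^{#ι}` elements (§1), all
admissible (§2), and injects into `h1Unramified A S` by the reverse bridge `natCard_characters_le_natCard_h1Unramified`.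
[cite: SerreGaloisCohomology1997, I.§2.6 (b)] [cite: Washington1997, §10.2 (reflection: the Kummer characters of the even radicals)]
[cite: Gras2003, Ch. II §5.4] -/
theorem pow_card_le_natCard_h1Unramified_of_characters (hcard : Nat.card A = p)
    (hcont : ∀ a : A, Continuous fun g : absoluteGaloisGroup ℚ ↦ g • a)
    (θ : absoluteGaloisGroup ℚ →* (ZMod p)ˣ)
    (hθ : ∀ (g : absoluteGaloisGroup ℚ) (a : A), g • a = (((θ g : ZMod p).val : ℕ) : ℤ) • a)
    (hpL : ¬ p ∣ Module.finrank ℚ L) (hrL : ∀ σ : absoluteGaloisGroup L, θ (absGaloisRestrict ℚ L σ) = 1)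
    {S : Set (HeightOneSpectrum (𝓞 ℚ))} (hS : S.Finite)
    (κ : ι → (absoluteGaloisGroup L →* Multiplicative (ZMod p)))
    (hopen : ∀ i, IsOpen ((κ i).ker : Set (absoluteGaloisGroup L)))
    (hunr : ∀ i, ∀ u : HeightOneSpectrum (𝓞 L), u.under (𝓞 ℚ) ∉ S →
      ∀ 𝔔 ∈ u.primesAbove, ∀ g ∈ 𝔔.inertia (absoluteGaloisGroup L), κ i g = 1)
    (heq : ∀ i, ∀ (γ : absoluteGaloisGroup ℚ) (σ : absoluteGaloisGroup L),
      κ i (absGaloisOuterConj ℚ L γ σ) = κ i σ ^ ((θ γ : (ZMod p)ˣ) : ZMod p).val)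
    (hind : ∀ n : ι → ℕ, ∏ i, κ i ^ n i = 1 → ∀ i, p ∣ n i) :
    p ^ Fintype.card ι ≤ Nat.card ↥(h1Unramified A S) := by
  set V := Subgroup.closure (Set.range κ) with hV
  haveI : Finite V := finite_closure_range κ
  refine (pow_card_le_natCard_closure_range hind).trans
    (natCard_characters_le_natCard_h1Unramified hcard hcont θ hθ hpL hrL hS V ?_ ?_ ?_)
  · intro χ hχ
    obtain ⟨n, -, rfl⟩ := exists_eq_prod_pow_of_mem_closure_range κ hχ
    exact isOpen_ker_prod_pow hopen n
  · intro χ hχ u hu 𝔔 h𝔔 g hg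
    obtain ⟨n, -, rfl⟩ := exists_eq_prod_pow_of_mem_closure_range κ hχ
    exact prod_pow_apply_eq_one (fun i => hunr i u hu 𝔔 h𝔔 g hg) n
  · intro χ hχ γ σ
    obtain ⟨n, -, rfl⟩ := exists_eq_prod_pow_of_mem_closure_range κ hχ
    exact prod_pow_apply_eq_pow (fun i => heq i γ σ) n

end Supply

/-! ## §4 On the CM-ramified class: (LA) ∧ an admissible independent family ⟹ `p^{#ι} ≤ #Sel_p`, `p^{#ι−1} ≤ #Ш[p]` -/

section Class

variable (W : WeierstrassCurve ℚ) [W.IsElliptic] [W.IsGloballyMinimal]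
variable {p : ℕ} [hp : Fact p.Prime] {ι : Type} [Fintype ι]

/-- **(LA) ⟹ `#R_rel(Φ) ≤ #Sel_p(W/ℚ)` ON THE CM-RAMIFIED CLASS, granted the local Euler characteristic — the QUANTITATIVE form of
w2 g10's `exists_sha_ne_zero_of_forall_exists_adaptedRoot_of_sq_le_of_cmRamified`.** `W/ℚ` globally minimal with CM, `p ≥ 5` ramified
in the CM field, `v ∋ p`, `Φ ≤ W[p]` a stable line of order `p` such that every rational local point `P ∈ W(ℚ_v)` has a `Φ`-adapted `p`-th
root (w6 g4's (LA)); ASSUME `localEulerPoincareCharacteristic ℚ_v`. THEN **`#h1Unramified Φ.Sub S_p ≤ #Sel_p(W/ℚ)`**: the class supplies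
`W(ℚ_v)[p] = 0`, `Φ^{D_p} = 0`, the non-cyclotomic homothety, so (LA) ⟹ CO-ALIGNED (`coaligned_of_forall_exists_adaptedRoot`), and the
class supplies `Φ.Quot^{Γ_ℚ} = 0`, `W(ℚ_ℓ)[p] = 0` at the bad `ℓ ≠ p` for `natCard_h1Unramified_le_natCard_selmerGroup_of_coaligned`.
[cite: MilneADT2006, Ch. I §2 Thm. 2.8] [cite: SerreGaloisCohomology1997, I.§2.6 (b) and I.§5.1] [cite: GrossLMS1991, §9] -/
theorem natCard_h1Unramified_le_natCard_selmerGroup_of_forall_exists_adaptedRoot_of_cmRamified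
    (hCM : W.HasCM) (hram : CMRamified W p) (h5 : 5 ≤ p)
    {v : HeightOneSpectrum (𝓞 ℚ)} (hpv : ((p : ℕ) : 𝓞 ℚ) ∈ v.asIdeal)
    (hEP : localEulerPoincareCharacteristic (v.adicCompletion ℚ))
    (Φ : StableSubgroup (absoluteGaloisGroup ℚ) (geomTorsion W (p : ℤ))) (hcard : Nat.card Φ.Sub = p)
    (hLA : ∀ P : (W.baseChange (v.adicCompletion ℚ)).toAffine.Point,
      ∃ R : localPoints W (v.adicCompletion ℚ),
        (p : ℤ) • R = Affine.Point.map (W' := W)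
          (IsScalarTower.toAlgHom ℚ (v.adicCompletion ℚ) (AlgebraicClosure (v.adicCompletion ℚ))) P ∧
        ∀ σ : absoluteGaloisGroup (v.adicCompletion ℚ), ∃ t ∈ Φ.toAddSubgroup,
          σ • R - R = pointsMap W (v.adicCompletion ℚ) (t : geomPoints W)) :
    Nat.card ↥(h1Unramified Φ.Sub {v' : HeightOneSpectrum (𝓞 ℚ) | ((p : ℕ) : 𝓞 ℚ) ∈ v'.asIdeal}) ≤
      Nat.card (selmerGroup W (p : ℤ)) := by
  have hpr : p.Prime := hp.out
  have hp2 : p ≠ 2 := by omega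
  have htors : Nat.card (nsmulAddMonoidHom p :
      (W.baseChange (v.adicCompletion ℚ)).toAffine.Point →+ _).ker = 1 :=
    (W.natCard_ker_nsmul_adicCompletion_eq_one_iff hpv p).2
      (RamifiedSevenEllipticUnits.prime_nsmul_eq_zero_padic_of_hasCM_of_cmRamified W p hCM h5 hram)
  have hSD : ∀ s : Φ.Sub, (∀ g ∈ decomp v, g • s = s) → s = 0 := fun s hs ↦
    LevelDictionaryAlpha.sub_eq_zero_of_forall_inertia_smul_eq_at_p W Φ hCM h5 hram hcard hpv
      (adicCompletionPrime_mem_primesAbove ℚ v) s fun g hg ↦ hs g (by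
        have h := Ideal.inertia_le_decompositionSubgroup (absoluteGaloisGroup ℚ) (adicCompletionPrime ℚ v) hg
        rw [decompositionSubgroup_adicCompletionPrime_eq_range] at h
        exact h)
  have hSμ := exists_decomp_homothety_ne_cyclotomic_of_cmRamified W hCM h5 hram Φ hcard hpv
  have hQΓ : ∀ q : Φ.Quot, (∀ g : absoluteGaloisGroup ℚ, g • q = q) → q = 0 := fun q hq ↦
    LevelDictionaryAlpha.quot_eq_zero_of_forall_inertia_smul_eq_at_p W Φ hCM h5 hram hcard hpv
      (adicCompletionPrime_mem_primesAbove ℚ v) q fun g _ ↦ hq g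
  have hbad : ∀ v' : HeightOneSpectrum (𝓞 ℚ), ¬ W.HasGoodReductionAt v' → ((p : ℕ) : 𝓞 ℚ) ∉ v'.asIdeal →
      ∀ P : (W.baseChange (v'.adicCompletion ℚ)).toAffine.Point, p • P = 0 → P = 0 :=
    fun v' hg hpv' ↦ LevelDictionaryAlpha.forall_prime_nsmul_eq_zero_adicCompletion_of_bad (K := ℚ) W hCM hram h5 hpv' hg
  refine natCard_h1Unramified_le_natCard_selmerGroup_of_coaligned W p hp2 Φ hQΓ hbad (fun w v' hv' ↦ ?_)
  have hvv : v' = v := Rat.HeightOneSpectrum.primesEquiv.injective (Subtype.ext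
    ((LevelDictionary.primesEquiv_eq_of_natCast_mem v' hp.out hv').trans
      (LevelDictionary.primesEquiv_eq_of_natCast_mem v hp.out hpv).symm))
  subst hvv
  exact coaligned_of_forall_exists_adaptedRoot W v' Φ hv' hEP htors hcard hSD hSμ hLA w

/-- **(LA) ∧ AN ADMISSIBLE INDEPENDENT FAMILY OF `#ι` `θ`-ISOTYPIC CHARACTERS ⟹ `p^{#ι} ≤ #Sel_p(W/ℚ)` AND `p^{#ι−1} ≤ #Ш(W/ℚ)[p]`
ON THE RANK-ONE CM-RAMIFIED CLASS, granted the local Euler characteristic.** `W/ℚ` globally minimal with CM, `p ≥ 5` ramified in the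
CM field, `rank W(ℚ) = 1`, `v ∋ p`, `Φ ≤ W[p]` a stable line of order `p` on which `Γ_ℚ` acts through `θ : Γ_ℚ →* 𝔽_pˣ`, satisfying
w6 g4's (LA) at `v` (CASE R when `Φ` carries the odd character); `L/ℚ` finite Galois with `p ∤ [L:ℚ]` and `θ(res Γ_L) = 1`;
`κ : ι → (Γ_L →* 𝔽_p)` with open kernels, trivial on the inertia groups above every `u ∤ p`, `θ`-isotypic under the outer action of `Γ_ℚ`,
INDEPENDENT; ASSUME `localEulerPoincareCharacteristic ℚ_v`. THEN `p^{#ι} ≤ #R_rel(Φ) ≤ #Sel_p(W/ℚ) = p · #Ш(W/ℚ)[p]` (rank one, no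
`p`-torsion: `ParitySplit.natCard_selmerGroup_eq_mul_of_rank_one`), so **`p^{#ι} ≤ #Sel_p(W/ℚ)`** and **`p^{#ι − 1} ≤ #(Ш(W/ℚ) ⊓ Ш[p])`**.
READING (B1-sha): with `L = K'` the CM field of the odd character, `κ` = the Kummer characters of Herbrand's even unit and of the class
radicals of `r` independent `θ_e`-eigenclasses (`KummerRadical.exists_independent_kummer_characters`, `#ι = r + 1`), this is the p-RANK
LOWER BOUND «CASE R ⟹ `dim_𝔽_p Ш(W_ψ)[p] ≥ rank_p e_{θ_e}(Cl K')`», the twin of w4 g10's upper bound `#Sel_p ≤ p²·t²`.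
[cite: MilneADT2006, Ch. I §2 Thm. 2.8] [cite: Washington1997, §10.2] [cite: SilvermanAEC2009, Thm. X.4.2] [cite: Gras2003, Ch. II §5.4] -/
theorem pow_card_le_natCard_selmerGroup_of_forall_exists_adaptedRoot_of_characters_of_cmRamified
    (hCM : W.HasCM) (hram : CMRamified W p) (h5 : 5 ≤ p) (hrank : W.mordellWeilRank = 1)
    {v : HeightOneSpectrum (𝓞 ℚ)} (hpv : ((p : ℕ) : 𝓞 ℚ) ∈ v.asIdeal)
    (hEP : localEulerPoincareCharacteristic (v.adicCompletion ℚ))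
    (Φ : StableSubgroup (absoluteGaloisGroup ℚ) (geomTorsion W (p : ℤ))) (hcard : Nat.card Φ.Sub = p)
    (hLA : ∀ P : (W.baseChange (v.adicCompletion ℚ)).toAffine.Point,
      ∃ R : localPoints W (v.adicCompletion ℚ),
        (p : ℤ) • R = Affine.Point.map (W' := W)
          (IsScalarTower.toAlgHom ℚ (v.adicCompletion ℚ) (AlgebraicClosure (v.adicCompletion ℚ))) P ∧
        ∀ σ : absoluteGaloisGroup (v.adicCompletion ℚ), ∃ t ∈ Φ.toAddSubgroup,
          σ • R - R = pointsMap W (v.adicCompletion ℚ) (t : geomPoints W))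
    (θ : absoluteGaloisGroup ℚ →* (ZMod p)ˣ)
    (hθ : ∀ (g : absoluteGaloisGroup ℚ) (s : Φ.Sub), g • s = (((θ g : ZMod p).val : ℕ) : ℤ) • s)
    {L : Type} [Field L] [NumberField L] [IsGalois ℚ L] (hpL : ¬ p ∣ Module.finrank ℚ L)
    (hrL : ∀ σ : absoluteGaloisGroup L, θ (absGaloisRestrict ℚ L σ) = 1)
    (κ : ι → (absoluteGaloisGroup L →* Multiplicative (ZMod p)))
    (hopen : ∀ i, IsOpen ((κ i).ker : Set (absoluteGaloisGroup L)))
    (hunr : ∀ i, ∀ u : HeightOneSpectrum (𝓞 L), ((p : ℕ) : 𝓞 L) ∉ u.asIdeal →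
      ∀ 𝔔 ∈ u.primesAbove, ∀ g ∈ 𝔔.inertia (absoluteGaloisGroup L), κ i g = 1)
    (heq : ∀ i, ∀ (γ : absoluteGaloisGroup ℚ) (σ : absoluteGaloisGroup L),
      κ i (absGaloisOuterConj ℚ L γ σ) = κ i σ ^ ((θ γ : (ZMod p)ˣ) : ZMod p).val)
    (hind : ∀ n : ι → ℕ, ∏ i, κ i ^ n i = 1 → ∀ i, p ∣ n i) :
    p ^ Fintype.card ι ≤ Nat.card (selmerGroup W (p : ℤ)) ∧
      p ^ (Fintype.card ι - 1) ≤ Nat.card (W.sha ⊓ AddSubgroup.torsionBy W.galH1 p : AddSubgroup W.galH1) := by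
  have hpr : p.Prime := hp.out
  have hp0 : ((p : ℕ) : ℤ) ≠ 0 := by exact_mod_cast hpr.ne_zero
  have hSpfin : {v' : HeightOneSpectrum (𝓞 ℚ) | ((p : ℕ) : 𝓞 ℚ) ∈ v'.asIdeal}.Finite := by
    convert finite_setOf_intCast_mem_asIdeal (K := ℚ) hp0 using 1
    ext v'
    simp only [Set.mem_setOf_eq, Int.cast_natCast]
  have hcont : ∀ s : Φ.Sub, Continuous fun g : absoluteGaloisGroup ℚ ↦ g • s :=
    Φ.continuous_smul_sub (LevelDictionary.continuous_smul_geomTorsion W (p : ℤ))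
  have hsupply := pow_card_le_natCard_h1Unramified_of_characters hcard hcont θ hθ hpL hrL hSpfin κ hopen
    (fun i u hu => hunr i u (natCast_not_mem_of_under_not_mem hu)) heq hind
  have hle := natCard_h1Unramified_le_natCard_selmerGroup_of_forall_exists_adaptedRoot_of_cmRamified W hCM hram h5 hpv hEP Φ
    hcard hLA
  have hsel : p ^ Fintype.card ι ≤ Nat.card (selmerGroup W (p : ℤ)) := hsupply.trans hle
  refine ⟨hsel, ?_⟩
  have htors : ∀ P : W.toAffine.Point, p • P = 0 → P = 0 := LevelDictionary.forall_nsmul_eq_zero_of_cmRamified W p hCM h5 hram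
  rw [ParitySplit.natCard_selmerGroup_eq_mul_of_rank_one W p hrank htors] at hsel
  rcases Nat.eq_zero_or_pos (Fintype.card ι) with h0 | hpos
  · rw [h0, Nat.zero_sub, pow_zero]
    refine Nat.one_le_iff_ne_zero.mpr fun h => ?_
    rw [h, mul_zero, h0, pow_zero] at hsel
    exact Nat.not_succ_le_zero 0 hsel
  · have h1 : p ^ Fintype.card ι = p * p ^ (Fintype.card ι - 1) := by
      rw [← pow_succ', Nat.sub_add_cancel hpos]
    rw [h1] at hsel
    exact Nat.le_of_mul_le_mul_left hsel hpr.pos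

end Class

end Summit.BirchSwinnertonDyer.BirchSwinnertonDyer.Theorems.PrintCFram.SelmerCount

end
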